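import Literature.Probability.Process.KolmogorovChentsov
import Mathlib.Topology.UniformSpace.HeineCantor
import Mathlib.MeasureTheory.Constructions.BorelSpace.Metrizable
import HarnessLib

/-!
# A measurable regularisation of paths which fixes the continuous ones

Trunk T-PROBABILITY (Literature/Probability/Process). On the canonical path space `ℝ≥0 → E`
(product σ-algebra; `E` a complete separable metric space) the set of continuous paths is not
measurable, and the evaluation `(t, w) ↦ w t` is not jointly measurable. Functionals of the path
which require continuity in time (time integrals, solutions of differential equations driven by the
path) are therefore applied to a **regularised** path:

* `Literature.pathRegularize w` — the extension from the dyadic rationals (`extendFrom dyadics w`) when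
  `w` is locally uniformly continuous on the dyadics (`Literature.Probability.Process.KolmogorovChentsov.LocallyUniformOnDyadics`,
  the deterministic half of the Kolmogorov–Chentsov construction of `KolmogorovChentsov.lean`),
  and the constant path `w 0` otherwise;

with the three properties that make it a drop-in device:

* every regularised path is continuous (`continuous_pathRegularize`);
* a continuous path is left unchanged (`pathRegularize_eq_self_of_continuous`);
* `w ↦ pathRegularize w t` is measurable for the product σ-algebra, jointly in `(w, t)`
  (`measurable_pathRegularize`, `measurable_uncurry_pathRegularize`); the regularity set is
  measurable (`measurableSet_setOf_locallyUniformOnDyadics`, a countable reformulation).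

Used to define the solution map of the Langevin SDE (additive noise) as a measurable functional of
the raw pair of driving paths which is the honest solution on continuous (e.g. Brownian, or
shifted Brownian) paths.

## References

* J.-F. Le Gall, *Brownian Motion, Martingales, and Stochastic Calculus* (2016), proof of Thm 2.9
  (extension from the dyadics of a path uniformly continuous on them). [folklore]
-/

noncomputable section

open MeasureTheory Filter Topology Set
open scoped NNReal ENNReal

namespace Literature.Probability.Process

open KolmogorovChentsov

variable {E : Type*} [EMetricSpace E]

/-! ### A countable reformulation of local uniform continuity on the dyadics -/

/-- Countable form of `LocallyUniformOnDyadics`: moduli `1/n`, radii `1/(m+1)`, dyadic points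
enumerated by level and index. [folklore] -/
theorem locallyUniformOnDyadics_iff (w : ℝ≥0 → E) :
    LocallyUniformOnDyadics w ↔ ∀ N n : ℕ, ∃ m : ℕ, ∀ a b c d : ℕ,
      dyad a b ≤ N → dyad c d ≤ N → dist (dyad a b) (dyad c d) < ((m : ℝ) + 1)⁻¹ →
        edist (w (dyad a b)) (w (dyad c d)) ≤ ((n : ℝ≥0∞))⁻¹ := by
  constructor
  · intro h N n
    rcases Nat.eq_zero_or_pos n with hn | hn
    · exact ⟨0, fun a b c d _ _ _ => by simp [hn]⟩
    have hε : (0 : ℝ≥0∞) < ((n : ℝ≥0∞))⁻¹ := by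
      simp only [ENNReal.inv_pos, ne_eq, ENNReal.natCast_ne_top, not_false_eq_true]
    obtain ⟨ρ, hρ, H⟩ := h N _ hε
    obtain ⟨m, hm⟩ := exists_nat_one_div_lt hρ
    refine ⟨m, fun a b c d ha hc hd => H _ (dyad_mem_dyadics _ _) _ (dyad_mem_dyadics _ _) ha hc ?_⟩
    exact hd.trans (by rw [one_div] at hm; exact hm)
  · intro h N ε hε
    obtain ⟨n, hn⟩ := ENNReal.exists_inv_nat_lt hε.ne'
    obtain ⟨m, hm⟩ := h N n
    refine ⟨((m : ℝ) + 1)⁻¹, by positivity, ?_⟩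
    rintro s ⟨a, b, rfl⟩ t ⟨c, d, rfl⟩ hs ht hst
    exact (hm a b c d hs ht hst).trans hn.le

variable [MeasurableSpace E] [BorelSpace E] [SecondCountableTopology E]

/-- The set of paths that are locally uniformly continuous on the dyadics is measurable for the
product σ-algebra (countably many conditions on countably many coordinates). [folklore] -/
theorem measurableSet_setOf_locallyUniformOnDyadics :
    MeasurableSet {w : ℝ≥0 → E | LocallyUniformOnDyadics w} := by
  have h : {w : ℝ≥0 → E | LocallyUniformOnDyadics w} = ⋂ N : ℕ, ⋂ n : ℕ, ⋃ m : ℕ,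
      ⋂ a : ℕ, ⋂ b : ℕ, ⋂ c : ℕ, ⋂ d : ℕ, ⋂ (_ : dyad a b ≤ N), ⋂ (_ : dyad c d ≤ N),
        ⋂ (_ : dist (dyad a b) (dyad c d) < ((m : ℝ) + 1)⁻¹),
          {w : ℝ≥0 → E | edist (w (dyad a b)) (w (dyad c d)) ≤ ((n : ℝ≥0∞))⁻¹} := by
    ext w
    simp only [mem_setOf_eq, locallyUniformOnDyadics_iff, mem_iInter, mem_iUnion]
  rw [h]
  refine MeasurableSet.iInter fun N => MeasurableSet.iInter fun n => MeasurableSet.iUnion fun m =>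
    MeasurableSet.iInter fun a => MeasurableSet.iInter fun b => MeasurableSet.iInter fun c =>
    MeasurableSet.iInter fun d => MeasurableSet.iInter fun _ => MeasurableSet.iInter fun _ =>
    MeasurableSet.iInter fun _ => ?_
  exact measurableSet_le ((measurable_pi_apply _).edist (measurable_pi_apply _)) measurable_const

/-! ### The regularisation -/

omit [MeasurableSpace E] [BorelSpace E] [SecondCountableTopology E] in
/-- A continuous path is locally uniformly continuous on the dyadics (Heine–Cantor on `[0, N]`).
[folklore] -/
theorem locallyUniformOnDyadics_of_continuous {w : ℝ≥0 → E} (hw : Continuous w) :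
    LocallyUniformOnDyadics w := by
  intro N ε hε
  have hu : UniformContinuousOn w (Icc 0 (N : ℝ≥0)) :=
    isCompact_Icc.uniformContinuousOn_of_continuous hw.continuousOn
  rw [EMetric.uniformContinuousOn_iff] at hu
  obtain ⟨δ, hδ, H⟩ := hu ε hε
  obtain ⟨δ', hδ'0, hδ'⟩ := ENNReal.lt_iff_exists_nnreal_btwn.1 hδ
  refine ⟨δ', by exact_mod_cast hδ'0, fun s _ t _ hs ht hst => ?_⟩
  have hs' : s ∈ Icc 0 (N : ℝ≥0) := ⟨by simp, hs⟩
  have ht' : t ∈ Icc 0 (N : ℝ≥0) := ⟨by simp, ht⟩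
  refine (H hs' ht' ?_).le
  calc edist s t = ENNReal.ofReal (dist s t) := edist_dist s t
    _ < δ' := by
        rw [← ENNReal.ofReal_coe_nnreal]
        exact ENNReal.ofReal_lt_ofReal_iff'.2 ⟨hst, by exact_mod_cast hδ'0⟩
    _ < δ := hδ'

open Classical in
/-- The **regularised path**: the extension from the dyadics of `w` if `w` is locally uniformly
continuous on the dyadics, and the constant path `w 0` otherwise (documented junk value).
Le Gall, *Brownian Motion, Martingales, and Stochastic Calculus* (2016), proof of Thm 2.9.
[folklore] -/
def pathRegularize (w : ℝ≥0 → E) (t : ℝ≥0) : E :=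
  if LocallyUniformOnDyadics w then extendFrom dyadics w t else w 0

omit [MeasurableSpace E] [BorelSpace E] [SecondCountableTopology E] in
/-- On the regularity set, the regularised path is the extension from the dyadics. [folklore] -/
theorem pathRegularize_of_locallyUniformOnDyadics {w : ℝ≥0 → E} (hw : LocallyUniformOnDyadics w)
    (t : ℝ≥0) : pathRegularize w t = extendFrom dyadics w t := by
  simp [pathRegularize, hw]

omit [MeasurableSpace E] [BorelSpace E] [SecondCountableTopology E] in
/-- Off the regularity set, the regularised path is the constant path `w 0`. [folklore] -/
theorem pathRegularize_of_not {w : ℝ≥0 → E} (hw : ¬ LocallyUniformOnDyadics w) (t : ℝ≥0) :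
    pathRegularize w t = w 0 := by
  simp [pathRegularize, hw]

variable [CompleteSpace E]

omit [MeasurableSpace E] [BorelSpace E] [SecondCountableTopology E] in
/-- **Every regularised path is continuous.** [folklore] -/
theorem continuous_pathRegularize (w : ℝ≥0 → E) : Continuous (pathRegularize w) := by
  by_cases hw : LocallyUniformOnDyadics w
  · have h : pathRegularize w = extendFrom dyadics w :=
      funext (pathRegularize_of_locallyUniformOnDyadics hw)
    rw [h]
    exact hw.continuous_extendFrom
  · have h : pathRegularize w = fun _ => w 0 := funext (pathRegularize_of_not hw)
    rw [h]
    exact continuous_const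

omit [MeasurableSpace E] [BorelSpace E] [SecondCountableTopology E] [CompleteSpace E] in
/-- **A continuous path is left unchanged** by the regularisation. [folklore] -/
theorem pathRegularize_eq_self_of_continuous {w : ℝ≥0 → E} (hw : Continuous w) :
    pathRegularize w = w := by
  funext t
  rw [pathRegularize_of_locallyUniformOnDyadics (locallyUniformOnDyadics_of_continuous hw)]
  exact extendFrom_eq (dense_dyadics t) (hw.continuousAt.continuousWithinAt)

omit [MeasurableSpace E] [BorelSpace E] [SecondCountableTopology E] in
/-- On the regularity set, the path converges along the dyadic approximations from below to the
regularised path. [folklore] -/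
theorem tendsto_pathRegularize {w : ℝ≥0 → E} (hw : LocallyUniformOnDyadics w) (t : ℝ≥0) :
    Tendsto (fun m : ℕ => w (dyad m ⌊(t : ℝ) * 2 ^ m⌋₊)) atTop (𝓝 (pathRegularize w t)) := by
  rw [pathRegularize_of_locallyUniformOnDyadics hw]
  exact (tendsto_extendFrom (hw.exists_tendsto t)).comp (tendsto_dyad_floor t)

/-- **Measurability**: `w ↦ pathRegularize w t` is measurable for the product σ-algebra on paths
(a pointwise limit of evaluations at dyadic times, patched measurably off the regularity set).
[folklore] -/
@[fun_prop]
theorem measurable_pathRegularize (t : ℝ≥0) :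
    Measurable fun w : ℝ≥0 → E => pathRegularize w t := by
  classical
  set S : Set (ℝ≥0 → E) := {w | LocallyUniformOnDyadics w} with hS
  have hSm : MeasurableSet S := measurableSet_setOf_locallyUniformOnDyadics
  set u : ℕ → ℝ≥0 := fun m => dyad m ⌊(t : ℝ) * 2 ^ m⌋₊ with hu
  refine measurable_of_tendsto_metrizable' atTop
    (f := fun m => S.piecewise (fun w : ℝ≥0 → E => w (u m)) fun w => w 0)
    (fun m => Measurable.piecewise hSm (measurable_pi_apply _) (measurable_pi_apply _)) ?_
  rw [tendsto_pi_nhds]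
  intro w
  by_cases hw : LocallyUniformOnDyadics w
  · have hwS : w ∈ S := hw
    simp only [Set.piecewise_eq_of_mem _ _ _ hwS]
    exact tendsto_pathRegularize hw t
  · have hwS : w ∉ S := hw
    simp only [Set.piecewise_eq_of_notMem _ _ _ hwS, pathRegularize_of_not hw]
    exact tendsto_const_nhds

/-- Joint measurability of `(w, t) ↦ pathRegularize w t` (measurable in `w`, continuous in `t`).
[folklore] -/
theorem measurable_uncurry_pathRegularize :
    Measurable fun p : (ℝ≥0 → E) × ℝ≥0 => pathRegularize p.1 p.2 :=
  (measurable_uncurry_of_continuous_of_measurable (u := fun (t : ℝ≥0) (w : ℝ≥0 → E) =>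
    pathRegularize w t) continuous_pathRegularize measurable_pathRegularize).comp measurable_swap

omit [MeasurableSpace E] [BorelSpace E] [SecondCountableTopology E] in
/-- The regularised path as a function of real time `t ↦ pathRegularize w t⁺` is continuous.
[folklore] -/
theorem continuous_pathRegularize_toNNReal (w : ℝ≥0 → E) :
    Continuous fun t : ℝ => pathRegularize w t.toNNReal :=
  (continuous_pathRegularize w).comp continuous_real_toNNReal

end Literature.Probability.Process
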